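import Literature.MathematicalPhysics.KineticTheory.CollisionTubePullbackStretch
import Literature.MathematicalPhysics.KineticTheory.HardSphereCanonicalTorus
import Literature.Analysis.FluidPDE.HardSpherePhaseSpaceProofs
import HarnessLib

/-!
# The collision-cylinder pull-back along hard-sphere orbits: oscillation of the weight over the
# tube window (pathwise reduction of the continuity correction to the short-flight deficit)

Topic `Literature/MathematicalPhysics/KineticTheory` (proof item; wanted by the crux line
`even-rung-mean-variance` of `JParityClosure.EvenStressEnskog`, stmt-AtomisticToContinuum-13079, helper
stub `stub_continuityCorrectionRung0`).  In Boltzmann's collision-cylinder argument read on ONE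
hard-sphere orbit (CIP 1994 §2.2, App. 4.A; GST 2013 §4.1) the CONTINUITY CORRECTION
`R_cont = Σ_{collisions (s,i,j), s ≤ τ} |Ψ_c| ∫_{max(0,s−κε)}^{s} |(χg)(t, xᵢ(t)) − (χg)(s, xᵢ(s))| dt`
(`continuityCorrection`) of the pull-back is controlled PATHWISE by a collision sum of an explicit
velocity mark plus the SHORT-FLIGHT DEFICIT `R_short` (`shortFlightDeficit`) at the same `κ`:

* `abs_coneKernel_sub_coneKernel_le`, `abs_mollDensity_sub_le` — the cone mollifier `b_r` is
  `3/(πr⁴)`-Lipschitz for the minimal-image distance, hence the mollified empirical density is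
  Lipschitz in (mean displacement of the configuration, displacement of the point);
* `euclidDist_orbit_pos_le`, `norm_vel_pairFlightStart_le` — on the free stretch `[a, s]` of a particle
  (`a = pairFlightStart`, `orbit_pos_eq_of_forall_not_participates`) its displacement over a time `h`
  is `≤ h ‖v‖`, and the flight velocity before a collision of `(i, j)` has norm `≤ ‖vᵢ(s)‖ + ‖vⱼ(s)‖`
  (`reflectVel_orbit_eq`, energy of the pair);
* `abs_weightAt_sub_weightAt_le` — on `[a, s] ∩ [s − κε, s]` the weight `χ(·, xᵢ) g(σ³ρ_r(xᵢ))`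
  oscillates by at most the VELOCITY MARK `C_g u₁ + C_χ u₂` of `S = ‖vᵢ(s)‖ + ‖vⱼ(s)‖` built from
  moduli of continuity of `χ` on `[0, τ] × 𝕋³` and of `g` on `[0, 3σ³/(πr³)]`, given a bound `E₀` on
  the kinetic energy per particle and the mean-displacement inequality along the orbit (hypothesis
  `hMD`, the "Lipschitz clock" `n⁻¹ Σ d(x_m(t), x_m(s)) ≤ √(2E/n) |t − s|`);
* `setIntegral_abs_weightAt_sub_le`, `continuityCorrection_le` — integrating over the window, whose
  part before `a` has length `≤ (a − (s − κε))₊` and carries an oscillation `≤ 2 C_χ C_g`: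
  `R_cont ≤ κε · Σ_coll b(vᵢ, vⱼ) + 2 C_χ C_g · R_short` for every majorant `b` of the mark;
* small inputs of the probabilistic assembly: `exists_abs_bound_chi`, `exists_abs_bound_of_cutoff`,
  `lintegral_norm_sub_gauss_ne_top`, `coneKernel_le`, `mollDensity_le`, `norm_reflectVel_fst_le`.

## References

* C. Cercignani, R. Illner, M. Pulvirenti, *The Mathematical Theory of Dilute Gases* (1994), §2.2,
  App. 4.A. [CIPDiluteGases1994]
* I. Gallagher, L. Saint-Raymond, B. Texier, *From Newton to Boltzmann* (2013), Part II Ch. 4, §4.1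
  (Prop. 4.1.1, Def. 4.1.2). [GallagherSaintRaymondTexier2013]
-/

noncomputable section

open MeasureTheory Set Filter Topology
open scoped ENNReal InnerProductSpace BigOperators

namespace Literature.MathematicalPhysics.KineticTheory

open Literature.Analysis.FluidPDE

/-! ### The cone mollifier and the mollified density are Lipschitz -/

/-- The cone kernel is at most its peak value `3/(πr³)` (`r > 0`). [folklore] -/
theorem coneKernel_le {r : ℝ} (hr : 0 < r) (x y : T3) : coneKernel r x y ≤ 3 / (Real.pi * r ^ 3) := by
  unfold coneKernel
  refine mul_le_of_le_one_right (by positivity) (max_le ?_ zero_le_one)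
  have h0 : 0 ≤ Torus.euclidDist x y := by rw [Torus.euclidDist_eq]; exact norm_nonneg _
  linarith [div_nonneg h0 hr.le]

/-- The mollified empirical density is at most `3/(πr³)` (`r > 0`). [folklore] -/
theorem mollDensity_le {N : ℕ} {r : ℝ} (hr : 0 < r) (ζ : Config (N + 1) (Fin 3) T3) (y : T3) :
    mollDensity r ζ y ≤ 3 / (Real.pi * r ^ 3) := by
  unfold mollDensity
  rw [integral_empiricalMeasure]
  calc ((N + 1 : ℕ) : ℝ)⁻¹ * ∑ m, coneKernel r (ζ m).1 y
      ≤ ((N + 1 : ℕ) : ℝ)⁻¹ * ∑ _m : Fin (N + 1), 3 / (Real.pi * r ^ 3) := by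
        gcongr with m _
        exact coneKernel_le hr _ _
    _ = 3 / (Real.pi * r ^ 3) := by
        rw [Finset.sum_const, Finset.card_univ, Fintype.card_fin, nsmul_eq_mul, ← mul_assoc,
          inv_mul_cancel₀ (by positivity), one_mul]

/-- **The cone kernel is `3/(πr⁴)`-Lipschitz** in both arguments for the minimal-image distance.
[folklore] -/
theorem abs_coneKernel_sub_coneKernel_le {r : ℝ} (hr : 0 < r) (x x' y y' : T3) :
    |coneKernel r x y - coneKernel r x' y'| ≤
      3 / (Real.pi * r ^ 4) * (Torus.euclidDist x x' + Torus.euclidDist y y') := by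
  unfold coneKernel
  rw [← mul_sub, abs_mul, abs_of_pos (by positivity : (0 : ℝ) < 3 / (Real.pi * r ^ 3))]
  have h1 : |max (1 - Torus.euclidDist x y / r) 0 - max (1 - Torus.euclidDist x' y' / r) 0| ≤
      |Torus.euclidDist x y - Torus.euclidDist x' y'| / r := by
    refine (abs_max_sub_max_le_abs _ _ _).trans (le_of_eq ?_)
    rw [show (1 - Torus.euclidDist x y / r) - (1 - Torus.euclidDist x' y' / r) =
      -((Torus.euclidDist x y - Torus.euclidDist x' y') / r) by ring, abs_neg, abs_div, abs_of_pos hr]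
  have h2 : |Torus.euclidDist x y - Torus.euclidDist x' y'| ≤ Torus.euclidDist x x' + Torus.euclidDist y y' := by
    have t1 := euclidDist_triangle x x' y
    have t2 := euclidDist_triangle x' y' y
    have t3 := euclidDist_triangle x' x y'
    have t4 := euclidDist_triangle x y y'
    rw [Torus.euclidDist_comm y' y] at t2
    rw [Torus.euclidDist_comm x' x] at t3
    rw [abs_sub_le_iff]
    constructor <;> linarith
  calc 3 / (Real.pi * r ^ 3) * |max (1 - Torus.euclidDist x y / r) 0 - max (1 - Torus.euclidDist x' y' / r) 0|
      ≤ 3 / (Real.pi * r ^ 3) * ((Torus.euclidDist x x' + Torus.euclidDist y y') / r) := by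
        gcongr
        exact h1.trans (div_le_div_of_nonneg_right h2 hr.le)
    _ = 3 / (Real.pi * r ^ 4) * (Torus.euclidDist x x' + Torus.euclidDist y y') := by
        field_simp

/-- **The mollified density is Lipschitz** in (configuration, point):
`|ρ_r(ζ, y) − ρ_r(ζ', y')| ≤ 3/(πr⁴) · ((N+1)⁻¹ Σ_m d(x_m, x'_m) + d(y, y'))`. [folklore] -/
theorem abs_mollDensity_sub_le {N : ℕ} {r : ℝ} (hr : 0 < r) (ζ ζ' : Config (N + 1) (Fin 3) T3)
    (y y' : T3) :
    |mollDensity r ζ y - mollDensity r ζ' y'| ≤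
      3 / (Real.pi * r ^ 4) *
        (((N + 1 : ℕ) : ℝ)⁻¹ * ∑ m, Torus.euclidDist (ζ m).1 (ζ' m).1 + Torus.euclidDist y y') := by
  unfold mollDensity
  rw [integral_empiricalMeasure, integral_empiricalMeasure, ← mul_sub, ← Finset.sum_sub_distrib, abs_mul,
    abs_of_nonneg (by positivity : (0 : ℝ) ≤ ((N + 1 : ℕ) : ℝ)⁻¹)]
  have hn : (0 : ℝ) < ((N + 1 : ℕ) : ℝ) := by positivity
  calc ((N + 1 : ℕ) : ℝ)⁻¹ * |∑ m, (coneKernel r (ζ m).1 y - coneKernel r (ζ' m).1 y')|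
      ≤ ((N + 1 : ℕ) : ℝ)⁻¹ *
          ∑ m, 3 / (Real.pi * r ^ 4) * (Torus.euclidDist (ζ m).1 (ζ' m).1 + Torus.euclidDist y y') := by
        gcongr
        exact (Finset.abs_sum_le_sum_abs _ _).trans
          (Finset.sum_le_sum fun m _ => abs_coneKernel_sub_coneKernel_le hr _ _ _ _)
    _ = 3 / (Real.pi * r ^ 4) *
          (((N + 1 : ℕ) : ℝ)⁻¹ * ∑ m, Torus.euclidDist (ζ m).1 (ζ' m).1 + Torus.euclidDist y y') := by
        rw [← Finset.mul_sum, Finset.sum_add_distrib, Finset.sum_const, Finset.card_univ, Fintype.card_fin,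
          nsmul_eq_mul]
        field_simp

/-- The first pre-collisional velocity has norm at most `‖v‖ + ‖w‖` (energy of the pair is
preserved by the reflection). [folklore] -/
theorem norm_reflectVel_fst_le (n : V3) (p : V3 × V3) : ‖(reflectVel n p).1‖ ≤ ‖p.1‖ + ‖p.2‖ := by
  have h := norm_sq_reflectVel_fst_add_norm_sq_reflectVel_snd n p
  have h1 : ‖(reflectVel n p).1‖ ^ 2 ≤ (‖p.1‖ + ‖p.2‖) ^ 2 := by
    nlinarith [sq_nonneg ‖(reflectVel n p).2‖, norm_nonneg p.1, norm_nonneg p.2]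
  exact (pow_le_pow_iff_left₀ (norm_nonneg _) (by positivity) two_ne_zero).1 h1

/-! ### Free flight of one particle along a good orbit -/

section Orbit

variable {σ : ℝ} {N : ℕ} {Φ : HardSphereFlow (Torus.geometry (Fin 3)) (hsDiameter σ N) (N + 1)}
  {z : Config (N + 1) (Fin 3) T3}

/-- **Displacement on a free stretch.** If particle `k` takes part in no collision during `(a, b)`,
then for `t, t' ∈ [a, b]` its positions are at minimal-image distance `≤ |t − t'| ‖v_k(a)‖`.
[folklore] -/
theorem euclidDist_orbit_pos_le (hz : z ∈ Φ.good) (k : Fin (N + 1)) {a b : ℝ} (hab : a ≤ b)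
    (hk : ∀ u ∈ Ioo a b, ¬ Participates (Torus.geometry (Fin 3)) (hsDiameter σ N) (orbit σ N Φ z u) k)
    {t t' : ℝ} (ht : t ∈ Icc a b) (ht' : t' ∈ Icc a b) :
    Torus.euclidDist (orbit σ N Φ z t k).1 (orbit σ N Φ z t' k).1 ≤ |t - t'| * ‖(orbit σ N Φ z a k).2‖ := by
  rw [orbit_pos_eq_of_forall_not_participates hz k hab hk ht,
    orbit_pos_eq_of_forall_not_participates hz k hab hk ht']
  refine (Torus.euclidDist_translate_le _ _ _ _).trans (le_of_eq ?_)
  rw [Torus.euclidDist_self, zero_add, ← sub_smul, norm_smul, Real.norm_eq_abs]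
  congr 2
  ring

/-- **The flight velocity before a collision is bounded by the post-collisional speeds.**  At a
collision `s > 0` of the ordered contact pair `(i, j)`, the velocity of `i` at the pair flight start
`a` (its velocity on the whole free stretch `[a, s)`) has norm `≤ ‖vᵢ(s)‖ + ‖vⱼ(s)‖`. [folklore] -/
theorem norm_vel_pairFlightStart_le (hz : z ∈ Φ.good) {i j : Fin (N + 1)} {s : ℝ} (hs : 0 < s)
    (hp : (i, j) ∈ contactPairs (Torus.geometry (Fin 3)) (hsDiameter σ N) (orbit σ N Φ z s)) :
    ‖(orbit σ N Φ z (pairFlightStart σ N Φ z i j s) i).2‖ ≤ ‖(orbit σ N Φ z s i).2‖ + ‖(orbit σ N Φ z s j).2‖ := by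
  have ha := pairFlightStart_lt hz i j hs
  have h := reflectVel_orbit_eq hz ha
    (fun u hu => (not_participates_of_mem_Ioo_pairFlightStart hz i j hu).1)
    (fun u hu => (not_participates_of_mem_Ioo_pairFlightStart hz i j hu).2) hp
  have h1 := norm_reflectVel_fst_le (sepAt (orbit σ N Φ z s) i j) ((orbit σ N Φ z s i).2, (orbit σ N Φ z s j).2)
  rw [h] at h1
  exact h1

end Orbit


/-! ### Small analytic inputs of the assembly -/

/-- A continuous `χ` is bounded on `[0, τ] × 𝕋³`. [folklore] -/
theorem exists_abs_bound_chi {χ : ℝ × UnitAddTorus (Fin 3) → ℝ} (hχ : Continuous χ) (τ : ℝ) :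
    ∃ C : ℝ, 0 ≤ C ∧ ∀ t ∈ Icc (0 : ℝ) τ, ∀ x, |χ (t, x)| ≤ C := by
  obtain ⟨C, hC⟩ := ((isCompact_Icc (a := (0 : ℝ)) (b := τ)).prod
    (isCompact_univ (X := UnitAddTorus (Fin 3)))).exists_bound_of_continuousOn hχ.continuousOn
  refine ⟨max C 0, le_max_right _ _, fun t ht x => ?_⟩
  have h := hC (t, x) ⟨ht, mem_univ _⟩
  rw [Real.norm_eq_abs] at h
  exact h.trans (le_max_left _ _)

/-- A continuous `g` vanishing on `[η₀, ∞)` is bounded in absolute value on `[0, ∞)`. [folklore] -/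
theorem exists_abs_bound_of_cutoff {g : ℝ → ℝ} {η₀ : ℝ} (hg : Continuous g) (hg1 : ∀ b, η₀ ≤ b → g b = 0) :
    ∃ C : ℝ, 0 ≤ C ∧ ∀ x, 0 ≤ x → |g x| ≤ C := by
  obtain ⟨C, hC⟩ := (isCompact_Icc (a := (0 : ℝ)) (b := η₀)).exists_bound_of_continuousOn hg.continuousOn
  refine ⟨max C 0, le_max_right _ _, fun x hx => ?_⟩
  by_cases hxK : η₀ ≤ x
  · rw [hg1 x hxK, abs_zero]; exact le_max_right _ _
  · have h := hC x ⟨hx, (not_le.1 hxK).le⟩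
    rw [Real.norm_eq_abs] at h
    exact h.trans (le_max_left _ _)

/-- The Gaussian flux moment `∫ ‖w − v‖ dN(u,θ)^{⊗2}` is finite. [folklore] -/
theorem lintegral_norm_sub_gauss_ne_top (u : V3) (θ : ℝ) :
    ∫⁻ p, ENNReal.ofReal ‖p.2 - p.1‖ ∂((gaussMeasure u θ).prod (gaussMeasure u θ)) ≠ ∞ := by
  set γ := gaussMeasure u θ with hγ
  have h1 : ∀ p : V3 × V3, ENNReal.ofReal ‖p.2 - p.1‖ ≤ ‖p.1‖ₑ + ‖p.2‖ₑ := by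
    intro p
    rw [← ofReal_norm, ← ofReal_norm, ← ENNReal.ofReal_add (norm_nonneg _) (norm_nonneg _)]
    exact ENNReal.ofReal_le_ofReal (by rw [add_comm]; exact norm_sub_le _ _)
  have hint : Integrable (fun v : V3 => v) γ :=
    (ProbabilityTheory.IsGaussian.memLp_id γ 1 (by simp)).integrable le_rfl
  have hfin : ∫⁻ v, ‖v‖ₑ ∂γ < ∞ := hint.hasFiniteIntegral
  have hm1 : Measurable fun p : V3 × V3 => ‖p.1‖ₑ := by fun_prop
  have hm2 : Measurable fun p : V3 × V3 => ‖p.2‖ₑ := by fun_prop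
  have h2 : ∫⁻ p, ‖p.1‖ₑ ∂(γ.prod γ) = ∫⁻ v, ‖v‖ₑ ∂γ := by
    rw [lintegral_prod _ hm1.aemeasurable]
    simp only [lintegral_const, measure_univ, mul_one]
  have h3 : ∫⁻ p, ‖p.2‖ₑ ∂(γ.prod γ) = ∫⁻ v, ‖v‖ₑ ∂γ := by
    rw [lintegral_prod _ hm2.aemeasurable]
    simp only [lintegral_const, measure_univ, mul_one]
  refine ne_of_lt ?_
  calc ∫⁻ p, ENNReal.ofReal ‖p.2 - p.1‖ ∂(γ.prod γ) ≤ ∫⁻ p, (‖p.1‖ₑ + ‖p.2‖ₑ) ∂(γ.prod γ) := lintegral_mono h1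
    _ = ∫⁻ v, ‖v‖ₑ ∂γ + ∫⁻ v, ‖v‖ₑ ∂γ := by rw [lintegral_add_left hm1, h2, h3]
    _ < ∞ := ENNReal.add_lt_top.2 ⟨hfin, hfin⟩

/-! ### The oscillation of the weight over the window of a collision -/

/-- **Controlled oscillation.** At a collision `s > 0` of the ordered contact pair `(i, j)` of a good
orbit with kinetic energy per particle `≤ E₀` obeying the mean-displacement inequality `hMD`
(`n⁻¹ Σ_m d(x_m(t), x_m(s)) ≤ √(2E/n) |t − s|`, the "Lipschitz clock" of the orbit), for a time `t` of
the window `[max(0, s − κε), s]` AFTER the pair flight start, the weight `χ(·, xᵢ) g(σ³ρ_r(xᵢ))` read at `t` and at `s` differ by at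
most the velocity mark `C_g u₁ + C_χ u₂` of `S = ‖vᵢ(s)‖ + ‖vⱼ(s)‖`, where `u₁ = ϵ₁` if
`κε(1 + S) ≤ Δ₁` (modulus of `χ` on `[0,τ] × 𝕋³`) and `2C_χ` otherwise, `u₂ = ϵ₂` if
`σ³ · 3/(πr⁴) · κε (√(2E₀) + S) ≤ Δ₂` (modulus of `g` on `[0, 3σ³/(πr³)]`) and `2C_g` otherwise.
[folklore] -/
theorem abs_weightAt_sub_weightAt_le {σ : ℝ} {N : ℕ}
    {Φ : HardSphereFlow (Torus.geometry (Fin 3)) (hsDiameter σ N) (N + 1)} {z : Config (N + 1) (Fin 3) T3}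
    (hz : z ∈ Φ.good) (hσ : 0 < σ) {χ : ℝ × UnitAddTorus (Fin 3) → ℝ} {g : ℝ → ℝ} {r κ : ℝ} (hr : 0 < r)
    (hκ : 0 < κ) {τ Cχ Cg E₀ Δ₁ ϵ₁ Δ₂ ϵ₂ : ℝ} (hϵ₁ : 0 ≤ ϵ₁)
    (hχb : ∀ t ∈ Icc (0 : ℝ) τ, ∀ x, |χ (t, x)| ≤ Cχ) (hgb : ∀ a, 0 ≤ a → |g a| ≤ Cg)
    (hχuc : ∀ p ∈ Icc (0 : ℝ) τ ×ˢ (univ : Set T3), ∀ q ∈ Icc (0 : ℝ) τ ×ˢ (univ : Set T3),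
      dist p q ≤ Δ₁ → dist (χ p) (χ q) ≤ ϵ₁)
    (hguc : ∀ a ∈ Icc (0 : ℝ) (σ ^ 3 * (3 / (Real.pi * r ^ 3))), ∀ a' ∈ Icc (0 : ℝ) (σ ^ 3 * (3 / (Real.pi * r ^ 3))),
      dist a a' ≤ Δ₂ → dist (g a) (g a') ≤ ϵ₂)
    (hE : ((N + 1 : ℕ) : ℝ)⁻¹ * configEnergy z ≤ E₀)
    (hMD : ∀ s t : ℝ, ((N + 1 : ℕ) : ℝ)⁻¹ * ∑ m, Torus.euclidDist ((Φ.flow t z m).1) ((Φ.flow s z m).1) ≤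
      Real.sqrt (2 * (((N + 1 : ℕ) : ℝ)⁻¹ * configEnergy z)) * |t - s|)
    {s : ℝ} (hs : s ∈ Icc 0 τ) (hs0 : 0 < s) {i j : Fin (N + 1)}
    (hp : (i, j) ∈ contactPairs (Torus.geometry (Fin 3)) (hsDiameter σ N) (orbit σ N Φ z s))
    {t : ℝ} (ht : t ∈ Icc (max 0 (s - κ * hsDiameter σ N)) s) (hta : pairFlightStart σ N Φ z i j s ≤ t) :
    |weightAt σ N χ g r t (orbit σ N Φ z t) i - weightAt σ N χ g r s (orbit σ N Φ z s) i| ≤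
      Cg * (if κ * hsDiameter σ N * (1 + (‖(orbit σ N Φ z s i).2‖ + ‖(orbit σ N Φ z s j).2‖)) ≤ Δ₁ then ϵ₁ else 2 * Cχ) +
      Cχ * (if σ ^ 3 * (3 / (Real.pi * r ^ 4)) * (κ * hsDiameter σ N *
          (Real.sqrt (2 * E₀) + (‖(orbit σ N Φ z s i).2‖ + ‖(orbit σ N Φ z s j).2‖))) ≤ Δ₂ then ϵ₂ else 2 * Cg) := by
  have hε0 : 0 < hsDiameter σ N := hsDiameter_pos hσ N
  set a := pairFlightStart σ N Φ z i j s with hadef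
  set S := ‖(orbit σ N Φ z s i).2‖ + ‖(orbit σ N Φ z s j).2‖ with hSdef
  have hS0 : 0 ≤ S := by positivity
  have ha : a < s := pairFlightStart_lt hz i j hs0
  have hfree := fun u (hu : u ∈ Ioo a s) => not_participates_of_mem_Ioo_pairFlightStart hz i j hu
  -- times
  have hts : s - t ≤ κ * hsDiameter σ N := by
    have h1 := ht.1
    rw [max_le_iff] at h1
    linarith [h1.2]
  have hts0 : 0 ≤ s - t := sub_nonneg.2 ht.2
  have habs : |t - s| ≤ κ * hsDiameter σ N := by rw [abs_sub_comm, abs_of_nonneg hts0]; exact hts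
  have ht0τ : t ∈ Icc (0 : ℝ) τ := ⟨(le_max_left _ _).trans ht.1, ht.2.trans hs.2⟩
  have hκε : 0 ≤ κ * hsDiameter σ N := by positivity
  have hCχ : 0 ≤ Cχ := (abs_nonneg _).trans (hχb s hs (orbit σ N Φ z s i).1)
  have hCg : 0 ≤ Cg := (abs_nonneg _).trans (hgb 0 le_rfl)
  -- the flight velocity and the displacement of `i`
  have hv : ‖(orbit σ N Φ z a i).2‖ ≤ S := norm_vel_pairFlightStart_le hz hs0 hp
  have hdi : Torus.euclidDist (orbit σ N Φ z t i).1 (orbit σ N Φ z s i).1 ≤ κ * hsDiameter σ N * S := by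
    have h := euclidDist_orbit_pos_le hz i ha.le (fun u hu => (hfree u hu).1) ⟨hta, ht.2⟩ ⟨ha.le, le_rfl⟩
    exact h.trans (mul_le_mul habs hv (norm_nonneg _) hκε)
  -- the mean displacement of the configuration
  have hmd : ((N + 1 : ℕ) : ℝ)⁻¹ * ∑ m, Torus.euclidDist (orbit σ N Φ z t m).1 (orbit σ N Φ z s m).1 ≤
      κ * hsDiameter σ N * Real.sqrt (2 * E₀) := by
    have h := hMD s t
    simp only [orbit_apply]
    refine h.trans ?_
    rw [mul_comm (κ * hsDiameter σ N)]
    refine mul_le_mul (Real.sqrt_le_sqrt ?_) habs (abs_nonneg _) (Real.sqrt_nonneg _)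
    push_cast at hE ⊢
    linarith
  -- the mollified densities
  have hρ : |mollDensity r (orbit σ N Φ z t) (orbit σ N Φ z t i).1 - mollDensity r (orbit σ N Φ z s) (orbit σ N Φ z s i).1| ≤
      3 / (Real.pi * r ^ 4) * (κ * hsDiameter σ N * (Real.sqrt (2 * E₀) + S)) := by
    refine (abs_mollDensity_sub_le hr _ _ _ _).trans ?_
    rw [mul_add (κ * hsDiameter σ N)]
    gcongr
  have hρ0 : ∀ u, 0 ≤ σ ^ 3 * mollDensity r (orbit σ N Φ z u) (orbit σ N Φ z u i).1 := fun u =>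
    mul_nonneg (pow_nonneg hσ.le 3) (mollDensity_nonneg hr _ _)
  have hρM : ∀ u, σ ^ 3 * mollDensity r (orbit σ N Φ z u) (orbit σ N Φ z u i).1 ≤ σ ^ 3 * (3 / (Real.pi * r ^ 3)) :=
    fun u => mul_le_mul_of_nonneg_left (mollDensity_le hr _ _) (pow_nonneg hσ.le 3)
  -- the `χ` factor
  have hχ : |χ (t, (orbit σ N Φ z t i).1) - χ (s, (orbit σ N Φ z s i).1)| ≤
      (if κ * hsDiameter σ N * (1 + S) ≤ Δ₁ then ϵ₁ else 2 * Cχ) := by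
    split_ifs with hc
    · have hd : dist (t, (orbit σ N Φ z t i).1) (s, (orbit σ N Φ z s i).1) ≤ Δ₁ := by
        rw [Prod.dist_eq, max_le_iff]
        constructor
        · rw [Real.dist_eq]
          refine habs.trans (le_trans ?_ hc)
          nlinarith
        · calc dist (orbit σ N Φ z t i).1 (orbit σ N Φ z s i).1
              ≤ Torus.euclidDist (orbit σ N Φ z t i).1 (orbit σ N Φ z s i).1 := by
                rw [dist_eq_norm]; exact Torus.norm_sub_le_euclidDist_holds _ _
            _ ≤ κ * hsDiameter σ N * S := hdi
            _ ≤ κ * hsDiameter σ N * (1 + S) := by nlinarith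
            _ ≤ Δ₁ := hc
      have h := hχuc (t, (orbit σ N Φ z t i).1) ⟨ht0τ, mem_univ _⟩ (s, (orbit σ N Φ z s i).1) ⟨hs, mem_univ _⟩ hd
      rwa [Real.dist_eq] at h
    · calc |χ (t, (orbit σ N Φ z t i).1) - χ (s, (orbit σ N Φ z s i).1)|
          ≤ |χ (t, (orbit σ N Φ z t i).1)| + |χ (s, (orbit σ N Φ z s i).1)| := abs_sub _ _
        _ ≤ Cχ + Cχ := add_le_add (hχb t ht0τ _) (hχb s hs _)
        _ = 2 * Cχ := by ring
  -- the `g` factor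
  have hg' : |g (σ ^ 3 * mollDensity r (orbit σ N Φ z t) (orbit σ N Φ z t i).1) -
      g (σ ^ 3 * mollDensity r (orbit σ N Φ z s) (orbit σ N Φ z s i).1)| ≤
      (if σ ^ 3 * (3 / (Real.pi * r ^ 4)) * (κ * hsDiameter σ N * (Real.sqrt (2 * E₀) + S)) ≤ Δ₂ then ϵ₂ else 2 * Cg) := by
    split_ifs with hc
    · have hd : dist (σ ^ 3 * mollDensity r (orbit σ N Φ z t) (orbit σ N Φ z t i).1)
          (σ ^ 3 * mollDensity r (orbit σ N Φ z s) (orbit σ N Φ z s i).1) ≤ Δ₂ := by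
        rw [Real.dist_eq, ← mul_sub, abs_mul, abs_of_nonneg (pow_nonneg hσ.le 3)]
        exact (mul_le_mul_of_nonneg_left hρ (pow_nonneg hσ.le 3)).trans (by rw [← mul_assoc]; exact hc)
      have h := hguc _ ⟨hρ0 t, hρM t⟩ _ ⟨hρ0 s, hρM s⟩ hd
      rwa [Real.dist_eq] at h
    · calc |g (σ ^ 3 * mollDensity r (orbit σ N Φ z t) (orbit σ N Φ z t i).1) -
            g (σ ^ 3 * mollDensity r (orbit σ N Φ z s) (orbit σ N Φ z s i).1)|
          ≤ |g (σ ^ 3 * mollDensity r (orbit σ N Φ z t) (orbit σ N Φ z t i).1)| +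
            |g (σ ^ 3 * mollDensity r (orbit σ N Φ z s) (orbit σ N Φ z s i).1)| := abs_sub _ _
        _ ≤ Cg + Cg := add_le_add (hgb _ (hρ0 t)) (hgb _ (hρ0 s))
        _ = 2 * Cg := by ring
  -- combine
  have hu₁ : 0 ≤ (if κ * hsDiameter σ N * (1 + S) ≤ Δ₁ then ϵ₁ else 2 * Cχ) := by split_ifs <;> positivity
  unfold weightAt
  set χt := χ (t, (orbit σ N Φ z t i).1)
  set χs := χ (s, (orbit σ N Φ z s i).1)
  set gt := g (σ ^ 3 * mollDensity r (orbit σ N Φ z t) (orbit σ N Φ z t i).1)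
  set gs := g (σ ^ 3 * mollDensity r (orbit σ N Φ z s) (orbit σ N Φ z s i).1)
  have hsplit : χt * gt - χs * gs = (χt - χs) * gt + χs * (gt - gs) := by ring
  rw [hsplit]
  calc |(χt - χs) * gt + χs * (gt - gs)| ≤ |χt - χs| * |gt| + |χs| * |gt - gs| := by
        rw [← abs_mul, ← abs_mul]; exact abs_add_le _ _
    _ ≤ (if κ * hsDiameter σ N * (1 + S) ≤ Δ₁ then ϵ₁ else 2 * Cχ) * Cg +
          Cχ * (if σ ^ 3 * (3 / (Real.pi * r ^ 4)) * (κ * hsDiameter σ N * (Real.sqrt (2 * E₀) + S)) ≤ Δ₂ then ϵ₂ else 2 * Cg) :=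
        add_le_add (mul_le_mul hχ (hgb _ (hρ0 t)) (abs_nonneg _) hu₁)
          (mul_le_mul (hχb s hs _) hg' (abs_nonneg _) hCχ)
    _ = _ := by ring


/-- **The window integral of the oscillation.** At a collision `s ∈ [0, τ]` of the ordered contact
pair `(i, j)` of a good orbit with kinetic energy per particle `≤ E₀`, the integral over the window
`[max(0, s − κε), s]` of the oscillation of the weight is at most `κε` times the velocity mark of
`abs_weightAt_sub_weightAt_le` plus `2 C_χ C_g` times the deficit `(pairFlightStart − (s − κε))₊`
(on the part of the window before the pair flight start the oscillation is bounded crudely).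
[folklore] -/
theorem setIntegral_abs_weightAt_sub_le {σ : ℝ} {N : ℕ}
    {Φ : HardSphereFlow (Torus.geometry (Fin 3)) (hsDiameter σ N) (N + 1)} {z : Config (N + 1) (Fin 3) T3}
    (hz : z ∈ Φ.good) (hσ : 0 < σ) {χ : ℝ × UnitAddTorus (Fin 3) → ℝ} {g : ℝ → ℝ} {r κ : ℝ} (hr : 0 < r)
    (hκ : 0 < κ) {τ Cχ Cg E₀ Δ₁ ϵ₁ Δ₂ ϵ₂ : ℝ} (hϵ₁ : 0 ≤ ϵ₁) (hϵ₂ : 0 ≤ ϵ₂)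
    (hχb : ∀ t ∈ Icc (0 : ℝ) τ, ∀ x, |χ (t, x)| ≤ Cχ) (hgb : ∀ a, 0 ≤ a → |g a| ≤ Cg)
    (hχuc : ∀ p ∈ Icc (0 : ℝ) τ ×ˢ (univ : Set T3), ∀ q ∈ Icc (0 : ℝ) τ ×ˢ (univ : Set T3),
      dist p q ≤ Δ₁ → dist (χ p) (χ q) ≤ ϵ₁)
    (hguc : ∀ a ∈ Icc (0 : ℝ) (σ ^ 3 * (3 / (Real.pi * r ^ 3))), ∀ a' ∈ Icc (0 : ℝ) (σ ^ 3 * (3 / (Real.pi * r ^ 3))),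
      dist a a' ≤ Δ₂ → dist (g a) (g a') ≤ ϵ₂)
    (hE : ((N + 1 : ℕ) : ℝ)⁻¹ * configEnergy z ≤ E₀)
    (hMD : ∀ s t : ℝ, ((N + 1 : ℕ) : ℝ)⁻¹ * ∑ m, Torus.euclidDist ((Φ.flow t z m).1) ((Φ.flow s z m).1) ≤
      Real.sqrt (2 * (((N + 1 : ℕ) : ℝ)⁻¹ * configEnergy z)) * |t - s|)
    {s : ℝ} (hs : s ∈ Icc 0 τ) {i j : Fin (N + 1)}
    (hp : (i, j) ∈ contactPairs (Torus.geometry (Fin 3)) (hsDiameter σ N) (orbit σ N Φ z s)) :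
    ∫ t in Icc (max 0 (s - κ * hsDiameter σ N)) s,
        |weightAt σ N χ g r t (orbit σ N Φ z t) i - weightAt σ N χ g r s (orbit σ N Φ z s) i| ≤
      κ * hsDiameter σ N *
        (Cg * (if κ * hsDiameter σ N * (1 + (‖(orbit σ N Φ z s i).2‖ + ‖(orbit σ N Φ z s j).2‖)) ≤ Δ₁ then ϵ₁ else 2 * Cχ) +
          Cχ * (if σ ^ 3 * (3 / (Real.pi * r ^ 4)) * (κ * hsDiameter σ N *
            (Real.sqrt (2 * E₀) + (‖(orbit σ N Φ z s i).2‖ + ‖(orbit σ N Φ z s j).2‖))) ≤ Δ₂ then ϵ₂ else 2 * Cg)) +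
      2 * Cχ * Cg * max (pairFlightStart σ N Φ z i j s - (s - κ * hsDiameter σ N)) 0 := by
  have hε0 : 0 < hsDiameter σ N := hsDiameter_pos hσ N
  have hκε : 0 < κ * hsDiameter σ N := mul_pos hκ hε0
  have hCχ : 0 ≤ Cχ := (abs_nonneg _).trans (hχb s hs (orbit σ N Φ z s i).1)
  have hCg : 0 ≤ Cg := (abs_nonneg _).trans (hgb 0 le_rfl)
  set a := pairFlightStart σ N Φ z i j s with hadef
  set A := max 0 (s - κ * hsDiameter σ N) with hAdef
  set m : ℝ := Cg * (if κ * hsDiameter σ N * (1 + (‖(orbit σ N Φ z s i).2‖ + ‖(orbit σ N Φ z s j).2‖)) ≤ Δ₁ then ϵ₁ else 2 * Cχ) +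
      Cχ * (if σ ^ 3 * (3 / (Real.pi * r ^ 4)) * (κ * hsDiameter σ N *
        (Real.sqrt (2 * E₀) + (‖(orbit σ N Φ z s i).2‖ + ‖(orbit σ N Φ z s j).2‖))) ≤ Δ₂ then ϵ₂ else 2 * Cg) with hmdef
  have hm0 : 0 ≤ m := by
    rw [hmdef]
    refine add_nonneg (mul_nonneg hCg ?_) (mul_nonneg hCχ ?_) <;> split_ifs <;> positivity
  have hAs : A ≤ s := max_le hs.1 (by linarith)
  have hAge : s - κ * hsDiameter σ N ≤ A := le_max_right _ _
  set f : ℝ → ℝ := fun t => |weightAt σ N χ g r t (orbit σ N Φ z t) i - weightAt σ N χ g r s (orbit σ N Φ z s) i|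
    with hfdef
  set h : ℝ → ℝ := fun t => m + (Iio a).indicator (fun _ => 2 * Cχ * Cg) t with hhdef
  -- pointwise domination on the window
  have hpt : ∀ t ∈ Icc A s, f t ≤ h t := by
    intro t ht
    have ht0τ : t ∈ Icc (0 : ℝ) τ := ⟨(le_max_left _ _).trans ht.1, ht.2.trans hs.2⟩
    by_cases hlt : t < a
    · rw [hhdef]
      dsimp only
      rw [indicator_of_mem (show t ∈ Iio a from hlt)]
      have h1 := abs_weightAt_le (N := N) hχb hgb hσ.le hr ht0τ (orbit σ N Φ z t) i
      have h2 := abs_weightAt_le (N := N) hχb hgb hσ.le hr hs (orbit σ N Φ z s) i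
      calc f t ≤ |weightAt σ N χ g r t (orbit σ N Φ z t) i| + |weightAt σ N χ g r s (orbit σ N Φ z s) i| :=
            abs_sub _ _
        _ ≤ Cχ * Cg + Cχ * Cg := add_le_add h1 h2
        _ ≤ m + 2 * Cχ * Cg := by linarith
    · rw [hhdef]
      dsimp only
      rw [indicator_of_notMem (show t ∉ Iio a from hlt), add_zero]
      rcases eq_or_lt_of_le ht.2 with rfl | hlt'
      · rw [hfdef]
        dsimp only
        rw [sub_self, abs_zero]
        exact hm0
      · have hs0 : 0 < s := lt_of_le_of_lt ((le_max_left _ _).trans ht.1) hlt'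
        exact abs_weightAt_sub_weightAt_le hz hσ hr hκ hϵ₁ hχb hgb hχuc hguc hE hMD hs hs0 hp ht (not_lt.1 hlt)
  -- the integral of the majorant
  have hvolW : (volume (Icc A s)).toReal ≤ κ * hsDiameter σ N := by
    rw [Real.volume_Icc, ENNReal.toReal_ofReal (sub_nonneg.2 hAs)]
    linarith
  have hvolI : (volume (Iio a ∩ Icc A s)).toReal ≤ max (a - (s - κ * hsDiameter σ N)) 0 := by
    have h1 : volume (Iio a ∩ Icc A s) ≤ ENNReal.ofReal (a - A) := by
      rw [← Real.volume_Icc]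
      exact measure_mono fun t ht => ⟨ht.2.1, le_of_lt ht.1⟩
    calc (volume (Iio a ∩ Icc A s)).toReal ≤ (ENNReal.ofReal (a - A)).toReal :=
          ENNReal.toReal_mono ENNReal.ofReal_ne_top h1
      _ = max (a - A) 0 := ENNReal.toReal_ofReal' 
      _ ≤ max (a - (s - κ * hsDiameter σ N)) 0 := max_le_max (by linarith) le_rfl
  have hh1 : IntegrableOn (fun _ : ℝ => m) (Icc A s) volume := integrableOn_const (hs := measure_Icc_lt_top.ne)
  have hh2 : IntegrableOn ((Iio a).indicator fun _ : ℝ => 2 * Cχ * Cg) (Icc A s) volume :=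
    IntegrableOn.indicator (integrableOn_const (hs := measure_Icc_lt_top.ne)) measurableSet_Iio
  have hint : ∫ t in Icc A s, h t = m * (volume (Icc A s)).toReal + 2 * Cχ * Cg * (volume (Iio a ∩ Icc A s)).toReal := by
    rw [hhdef]
    show ∫ t in Icc A s, (m + (Iio a).indicator (fun _ : ℝ => 2 * Cχ * Cg) t) = _
    rw [integral_add hh1 hh2, setIntegral_const, integral_indicator measurableSet_Iio, setIntegral_const,
      measureReal_restrict_apply measurableSet_Iio, measureReal_def, measureReal_def, smul_eq_mul, smul_eq_mul]
    ring
  by_cases hI : IntegrableOn f (Icc A s)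
  · have hh : IntegrableOn h (Icc A s) := hh1.add hh2
    have hC2 : 0 ≤ 2 * Cχ * Cg := mul_nonneg (mul_nonneg zero_le_two hCχ) hCg
    calc ∫ t in Icc A s, f t ≤ ∫ t in Icc A s, h t := setIntegral_mono_on hI hh measurableSet_Icc hpt
      _ = m * (volume (Icc A s)).toReal + 2 * Cχ * Cg * (volume (Iio a ∩ Icc A s)).toReal := hint
      _ ≤ m * (κ * hsDiameter σ N) + 2 * Cχ * Cg * max (a - (s - κ * hsDiameter σ N)) 0 :=
          add_le_add (mul_le_mul_of_nonneg_left hvolW hm0) (mul_le_mul_of_nonneg_left hvolI hC2)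
      _ = κ * hsDiameter σ N * m + 2 * Cχ * Cg * max (a - (s - κ * hsDiameter σ N)) 0 := by ring
  · rw [integral_undef hI]
    positivity

/-- **Pathwise reduction of the continuity correction.**  On a good orbit with kinetic energy per
particle `≤ E₀` and `|Ψ| ≤ C_Ψ`,
`R_cont ≤ κε · Σ_{collisions (s,i,j), s ≤ τ} b(vᵢ(s), vⱼ(s)) + 2 C_χ C_g · R_short` for every majorant `b`
of `C_Ψ` times the velocity mark of `abs_weightAt_sub_weightAt_le` (the deficit is taken at the same
`κ`). [folklore] -/
theorem continuityCorrection_le {σ : ℝ} {N : ℕ}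
    {Φ : HardSphereFlow (Torus.geometry (Fin 3)) (hsDiameter σ N) (N + 1)} {z : Config (N + 1) (Fin 3) T3}
    (hz : z ∈ Φ.good) (hσ : 0 < σ) {χ : ℝ × UnitAddTorus (Fin 3) → ℝ} {g : ℝ → ℝ} {Ψ : V3 × V3 × V3 → ℝ}
    {r κ : ℝ} (hr : 0 < r) (hκ : 0 < κ) {τ Cχ Cg CΨ E₀ Δ₁ ϵ₁ Δ₂ ϵ₂ : ℝ} (hϵ₁ : 0 ≤ ϵ₁) (hϵ₂ : 0 ≤ ϵ₂)
    (hχb : ∀ t ∈ Icc (0 : ℝ) τ, ∀ x, |χ (t, x)| ≤ Cχ) (hgb : ∀ a, 0 ≤ a → |g a| ≤ Cg) (hΨb : ∀ q, |Ψ q| ≤ CΨ)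
    (hχuc : ∀ p ∈ Icc (0 : ℝ) τ ×ˢ (univ : Set T3), ∀ q ∈ Icc (0 : ℝ) τ ×ˢ (univ : Set T3),
      dist p q ≤ Δ₁ → dist (χ p) (χ q) ≤ ϵ₁)
    (hguc : ∀ a ∈ Icc (0 : ℝ) (σ ^ 3 * (3 / (Real.pi * r ^ 3))), ∀ a' ∈ Icc (0 : ℝ) (σ ^ 3 * (3 / (Real.pi * r ^ 3))),
      dist a a' ≤ Δ₂ → dist (g a) (g a') ≤ ϵ₂)
    (hE : ((N + 1 : ℕ) : ℝ)⁻¹ * configEnergy z ≤ E₀)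
    (hMD : ∀ s t : ℝ, ((N + 1 : ℕ) : ℝ)⁻¹ * ∑ m, Torus.euclidDist ((Φ.flow t z m).1) ((Φ.flow s z m).1) ≤
      Real.sqrt (2 * (((N + 1 : ℕ) : ℝ)⁻¹ * configEnergy z)) * |t - s|)
    (b : V3 × V3 → ℝ)
    (hb : ∀ (s : ℝ) (i j : Fin (N + 1)), CΨ *
      (Cg * (if κ * hsDiameter σ N * (1 + (‖(orbit σ N Φ z s i).2‖ + ‖(orbit σ N Φ z s j).2‖)) ≤ Δ₁ then ϵ₁ else 2 * Cχ) +
        Cχ * (if σ ^ 3 * (3 / (Real.pi * r ^ 4)) * (κ * hsDiameter σ N *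
          (Real.sqrt (2 * E₀) + (‖(orbit σ N Φ z s i).2‖ + ‖(orbit σ N Φ z s j).2‖))) ≤ Δ₂ then ϵ₂ else 2 * Cg)) ≤
      b ((orbit σ N Φ z s i).2, (orbit σ N Φ z s j).2)) :
    continuityCorrection σ N Φ τ χ g Ψ r κ z ≤
      κ * hsDiameter σ N *
          collisionPairSum (Torus.geometry (Fin 3)) (hsDiameter σ N) (orbit σ N Φ z) (Icc 0 τ)
            (fun s i j => b ((orbit σ N Φ z s i).2, (orbit σ N Φ z s j).2)) +
        2 * Cχ * Cg * shortFlightDeficit σ N Φ τ Ψ κ z := by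
  have hfin : (collisionTimes (Torus.geometry (Fin 3)) (hsDiameter σ N) (orbit σ N Φ z) ∩ Icc 0 τ).Finite :=
    (isTraj hz).locFinite 0 τ
  have hε0 : 0 < hsDiameter σ N := hsDiameter_pos hσ N
  have hκε : 0 ≤ κ * hsDiameter σ N := (mul_pos hκ hε0).le
  unfold continuityCorrection shortFlightDeficit
  rw [← collisionPairSum_const_mul hfin, ← collisionPairSum_const_mul hfin, ← collisionPairSum_add hfin]
  refine collisionPairSum_mono hfin fun s hs p hp => ?_
  have hCχ : 0 ≤ Cχ := (abs_nonneg _).trans (hχb s hs.2 (orbit σ N Φ z s p.1).1)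
  have hCg : 0 ≤ Cg := (abs_nonneg _).trans (hgb 0 le_rfl)
  have hI := setIntegral_abs_weightAt_sub_le hz hσ hr hκ hϵ₁ hϵ₂ hχb hgb hχuc hguc hE hMD hs.2 (i := p.1) (j := p.2) hp
  set m : ℝ := Cg * (if κ * hsDiameter σ N * (1 + (‖(orbit σ N Φ z s p.1).2‖ + ‖(orbit σ N Φ z s p.2).2‖)) ≤ Δ₁ then ϵ₁ else 2 * Cχ) +
      Cχ * (if σ ^ 3 * (3 / (Real.pi * r ^ 4)) * (κ * hsDiameter σ N *
        (Real.sqrt (2 * E₀) + (‖(orbit σ N Φ z s p.1).2‖ + ‖(orbit σ N Φ z s p.2).2‖))) ≤ Δ₂ then ϵ₂ else 2 * Cg) with hmdef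
  have hm0 : 0 ≤ m := by
    rw [hmdef]
    refine add_nonneg (mul_nonneg hCg ?_) (mul_nonneg hCχ ?_) <;> split_ifs <;> positivity
  have hcm := hΨb ((hsDiameter σ N)⁻¹ • sepAt (orbit σ N Φ z s) p.1 p.2,
    (reflectVel (sepAt (orbit σ N Φ z s) p.1 p.2) ((orbit σ N Φ z s p.1).2, (orbit σ N Φ z s p.2).2)).1,
    (reflectVel (sepAt (orbit σ N Φ z s) p.1 p.2) ((orbit σ N Φ z s p.1).2, (orbit σ N Φ z s p.2).2)).2)
  change |collMark σ N Ψ (orbit σ N Φ z s) p.1 p.2| ≤ CΨ at hcm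
  calc |collMark σ N Ψ (orbit σ N Φ z s) p.1 p.2| *
        ∫ t in Icc (max 0 (s - κ * hsDiameter σ N)) s,
          |weightAt σ N χ g r t (orbit σ N Φ z t) p.1 - weightAt σ N χ g r s (orbit σ N Φ z s) p.1|
      ≤ |collMark σ N Ψ (orbit σ N Φ z s) p.1 p.2| *
          (κ * hsDiameter σ N * m + 2 * Cχ * Cg * max (pairFlightStart σ N Φ z p.1 p.2 s - (s - κ * hsDiameter σ N)) 0) :=
        mul_le_mul_of_nonneg_left hI (abs_nonneg _)
    _ = κ * hsDiameter σ N * (|collMark σ N Ψ (orbit σ N Φ z s) p.1 p.2| * m) +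
          2 * Cχ * Cg * (|collMark σ N Ψ (orbit σ N Φ z s) p.1 p.2| *
            max (pairFlightStart σ N Φ z p.1 p.2 s - (s - κ * hsDiameter σ N)) 0) := by ring
    _ ≤ κ * hsDiameter σ N * (CΨ * m) +
          2 * Cχ * Cg * (|collMark σ N Ψ (orbit σ N Φ z s) p.1 p.2| *
            max (pairFlightStart σ N Φ z p.1 p.2 s - (s - κ * hsDiameter σ N)) 0) := by
        gcongr
    _ ≤ κ * hsDiameter σ N * b ((orbit σ N Φ z s p.1).2, (orbit σ N Φ z s p.2).2) +
          2 * Cχ * Cg * (|collMark σ N Ψ (orbit σ N Φ z s) p.1 p.2| *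
            max (pairFlightStart σ N Φ z p.1 p.2 s - (s - κ * hsDiameter σ N)) 0) := by
        gcongr
        exact hb s p.1 p.2

end Literature.MathematicalPhysics.KineticTheory

end
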